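import Summits.NavierStokesRegularity.FluidComputer.PressureFace
import Literature.Analysis.FluidPDE.PressureCriterionLFour
import Literature.Analysis.FluidPDE.NSSerrinRegularity
import HarnessLib

/-!
# Fluid computer — the level dictionary, PRESSURE FACE QUANTIFIED (L46): the Serrin-scaled norms of the pressure
# and of the pressure gradient diverge on every terminal window (Chae–Lee / Berselli–Galdi / Zhou–Struwe)

HONEST FRAMING (cell `pub-fluidc`, verbatim): *low prior, high value-of-information experiment on Tao's
machine paradigm; NOT a claim that NS blows up.* Theorem side of the cell; nothing here is evidence of blow-up.
L38 says the normalised pressure `p̃ = R_iR_j(u_iu_j)` has no floor. The pressure analogues of the Prodi–Serrin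
criteria — `p̃ ∈ L^s_tL^r_x` with `2/s + 3/r = 2`, `3/2 < r < ∞` (Chae–Lee 2001, Berselli–Galdi 2002), and
`∇p ∈ L^s_tL^q_x` with `2/s + 3/q = 3`, `1 < q < ∞` (Berselli–Galdi 2002, Zhou 2006, Struwe 2007), in
Lemarié-Rieusset's continuation form (2016, Prop. 11.7) — are PROVED in the tree for classical Leray–Hopf solutions
with no decay hypothesis (`hasSmoothExtensionPast_of_normalisedPressure`, `pressureGradientCriterion_of_lt_three`,
`pressureGradientCriterion_of_three_le`: the `L⁴`/`L^θ` energy method on Tao's `H¹` patches). Read on the class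
(maximality; restart at an a.e.-good time for terminal windows, `MemLqLp.translate`), for every maximal smooth
solution `(u, p)` of the unforced Navier–Stokes system on `ℝ³ × [0, T)` (`ν > 0`) which is Leray–Hopf from `u 0`:

* `not_memLqLp_normalisedPressure(_window)` (**L46 — THE PRESSURE LEAVES EVERY SERRIN CLASS**): for every
  `3/2 < r < ∞`, `2/s + 3/r = 2` and every `t₀ ∈ [0, T)`: `p̃ ∉ L^s(t₀, T; L^r(ℝ³))` — i.e.
  `∫_{t₀}^{T} ‖p̃(t)‖_{L^r}^s dt = ∞` (e.g. `∫‖p̃‖_{L³}² = ∞`, `∫‖p̃‖_{L²}^4 = ∞`);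
* `not_memLqLp_pressureGradient(_window)` (**L46′ — SO DOES THE PRESSURE GRADIENT**): for every `1 < q < ∞`,
  `2/s + 3/q = 3`, `t₀ ∈ [0, T)`: `∇p ∉ L^s(t₀, T; L^q(ℝ³))` (the classical pressure `p`; its gradient is that of
  `p̃`);
* `pressure_serrin_face`: both assembled.

Reading for the machine paradigm (words): since `p̃ ∼ |u|²` in scaling, these are the Serrin rows of L30 in
pressure currency — the mean depth/steepness of the pressure wells must grow at the self-similar rates
`‖p̃(t)‖_{L^r} ≳ (T−t)^{−(2r−3)/(2r)}` in the `L^s(dt)` sense; a run whose pressure norms stay integrable at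
these exponents is not approaching a singularity. Class statements; no constants. Necessity only. 0 sorry; no new
definitions, no named facts.

## References

* P. G. Lemarié-Rieusset, *The Navier–Stokes Problem in the 21st Century*, CRC 2016, §11.5 Prop. 11.7.
  [LemarieRieusset2016]
* L. C. Berselli, G. P. Galdi, Proc. Amer. Math. Soc. 130 (2002) 3585–3595. [BerselliGaldi2002]
* D. Chae, J. Lee, Nonlinear Anal. 46 (2001) 727–735. [ChaeLee2001]
* G. Seregin, V. Šverák, Arch. Ration. Mech. Anal. 163 (2002) 65–86. [SereginSverak2002]
-/

noncomputable section

open MeasureTheory Set Function Filter Topology Metric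
open scoped ENNReal NNReal
open Literature.Analysis.FluidPDE Literature.Analysis.FunctionSpaces

namespace Summit.NavierStokesRegularity.FluidComputer.PressureSerrinFace

/-! ## L46: the normalised pressure leaves every Serrin class -/

/-- **L46 — `p̃ ∉ L^s(0, T; L^r)`, `2/s + 3/r = 2`, `3/2 < r < ∞`** (Lemarié-Rieusset 2016 Prop. 11.7 first item,
PROVED in the tree as `hasSmoothExtensionPast_of_normalisedPressure`, read against maximality).
[cite: LemarieRieusset2016, §11.5 Prop. 11.7 (PDF pp. 362–364)] -/
theorem not_memLqLp_normalisedPressure {ν T : ℝ} (hν : 0 < ν) (hT : 0 < T)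
    {u : ℝ → EuclideanSpace ℝ (Fin 3) → EuclideanSpace ℝ (Fin 3)} {p : ℝ → EuclideanSpace ℝ (Fin 3) → ℝ}
    (hmax : IsMaximalSmoothSolution ν 0 u p T) (hLH : IsLerayHopfOn T ν 0 (u 0) u)
    {s r : ℝ≥0∞} (hr : 3 / 2 < r) (hrtop : r < ⊤) (hsr : 2 / s + 3 / r = 2) :
    ¬ MemLqLp s r (fun t x => normalisedPressure (u t) x) (Ioo 0 T) :=
  fun hS => hmax.2 (hasSmoothExtensionPast_of_normalisedPressure ν T hν hT u p hmax.1 hLH s r hr hrtop hsr hS)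

/-- **L46 ON EVERY TERMINAL WINDOW**: for every `t₀ ∈ [0, T)`, `p̃ ∉ L^s(t₀, T; L^r)` — restart at an a.e.-good
time `s₁ ∈ (t₀, T)`: the translate `u(· + s₁)` is a maximal smooth solution with lifespan `T − s₁`, Leray–Hopf
from `u s₁`, and `MemLqLp` translates (`MemLqLp.translate`). [cite: LemarieRieusset2016, §11.5 Prop. 11.7] -/
theorem not_memLqLp_normalisedPressure_window {ν T : ℝ} (hν : 0 < ν)
    {u : ℝ → EuclideanSpace ℝ (Fin 3) → EuclideanSpace ℝ (Fin 3)} {p : ℝ → EuclideanSpace ℝ (Fin 3) → ℝ}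
    (hmax : IsMaximalSmoothSolution ν 0 u p T) (hLH : IsLerayHopfOn T ν 0 (u 0) u)
    {s r : ℝ≥0∞} (hr : 3 / 2 < r) (hrtop : r < ⊤) (hsr : 2 / s + 3 / r = 2)
    {t₀ : ℝ} (ht₀ : t₀ ∈ Ico 0 T) :
    ¬ MemLqLp s r (fun t x => normalisedPressure (u t) x) (Ioo t₀ T) := by
  intro hS
  obtain ⟨s₁, hs₁, hLHs⟩ := hLH.exists_isLerayHopfOn_restart_Ioo hν.le ht₀.1 ht₀.2 le_rfl
  have hs0 : 0 < s₁ := ht₀.1.trans_lt hs₁.1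
  have hTs : 0 < T - s₁ := sub_pos.2 hs₁.2
  have hmax' : IsMaximalSmoothSolution ν 0 (fun t => u (t + s₁)) (fun t => p (t + s₁)) (T - s₁) :=
    hmax.translate_zero hs0 hs₁.2
  have hLH' : IsLerayHopfOn (T - s₁) ν 0 ((fun t => u (t + s₁)) 0) (fun t => u (t + s₁)) := by
    show IsLerayHopfOn (T - s₁) ν 0 (u (0 + s₁)) (fun t => u (t + s₁))
    rw [zero_add]
    exact hLHs
  have hS' : MemLqLp s r (fun t x => normalisedPressure (u (t + s₁)) x) (Ioo 0 (T - s₁)) := by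
    have h := hS.mono_set (Ioo_subset_Ioo hs₁.1.le le_rfl)
    rw [show Ioo s₁ T = Ioo (0 + s₁) (T - s₁ + s₁) by rw [zero_add, sub_add_cancel]] at h
    exact h.translate s₁
  exact not_memLqLp_normalisedPressure hν hTs hmax' hLH' hr hrtop hsr hS'

/-! ## L46′: the pressure gradient leaves every Serrin class -/

/-- **L46′ — `∇p ∉ L^s(0, T; L^q)`, `2/s + 3/q = 3`, `1 < q < ∞`** (Lemarié-Rieusset 2016 Prop. 11.7 second item /
Berselli–Galdi / Zhou / Struwe, PROVED in the tree as `pressureGradientCriterion_of_lt_three` and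
`pressureGradientCriterion_of_three_le`, read against maximality). [cite: LemarieRieusset2016, §11.5 Prop. 11.7] -/
theorem not_memLqLp_pressureGradient {ν T : ℝ} (hν : 0 < ν) (hT : 0 < T)
    {u : ℝ → EuclideanSpace ℝ (Fin 3) → EuclideanSpace ℝ (Fin 3)} {p : ℝ → EuclideanSpace ℝ (Fin 3) → ℝ}
    (hmax : IsMaximalSmoothSolution ν 0 u p T) (hLH : IsLerayHopfOn T ν 0 (u 0) u)
    {s q : ℝ≥0∞} (h1q : 1 < q) (hqtop : q < ⊤) (hsq : 2 / s + 3 / q = 3) :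
    ¬ MemLqLp s q (fun t x => gradient (p t) x) (Ioo 0 T) := by
  intro hS
  rcases lt_or_ge q 3 with hq3 | h3q
  · exact hmax.2 (pressureGradientCriterion_of_lt_three ν T hν hT u p hmax.1 hLH s q h1q hq3 hsq hS)
  · exact hmax.2 (pressureGradientCriterion_of_three_le ν T hν hT u p hmax.1 hLH s q h3q hqtop hsq hS)

/-- **L46′ ON EVERY TERMINAL WINDOW**: for every `t₀ ∈ [0, T)`, `∇p ∉ L^s(t₀, T; L^q)`.
[cite: LemarieRieusset2016, §11.5 Prop. 11.7] -/
theorem not_memLqLp_pressureGradient_window {ν T : ℝ} (hν : 0 < ν)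
    {u : ℝ → EuclideanSpace ℝ (Fin 3) → EuclideanSpace ℝ (Fin 3)} {p : ℝ → EuclideanSpace ℝ (Fin 3) → ℝ}
    (hmax : IsMaximalSmoothSolution ν 0 u p T) (hLH : IsLerayHopfOn T ν 0 (u 0) u)
    {s q : ℝ≥0∞} (h1q : 1 < q) (hqtop : q < ⊤) (hsq : 2 / s + 3 / q = 3)
    {t₀ : ℝ} (ht₀ : t₀ ∈ Ico 0 T) :
    ¬ MemLqLp s q (fun t x => gradient (p t) x) (Ioo t₀ T) := by
  intro hS
  obtain ⟨s₁, hs₁, hLHs⟩ := hLH.exists_isLerayHopfOn_restart_Ioo hν.le ht₀.1 ht₀.2 le_rfl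
  have hs0 : 0 < s₁ := ht₀.1.trans_lt hs₁.1
  have hTs : 0 < T - s₁ := sub_pos.2 hs₁.2
  have hmax' : IsMaximalSmoothSolution ν 0 (fun t => u (t + s₁)) (fun t => p (t + s₁)) (T - s₁) :=
    hmax.translate_zero hs0 hs₁.2
  have hLH' : IsLerayHopfOn (T - s₁) ν 0 ((fun t => u (t + s₁)) 0) (fun t => u (t + s₁)) := by
    show IsLerayHopfOn (T - s₁) ν 0 (u (0 + s₁)) (fun t => u (t + s₁))
    rw [zero_add]
    exact hLHs
  have hS' : MemLqLp s q (fun t x => gradient (p (t + s₁)) x) (Ioo 0 (T - s₁)) := by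
    have h := hS.mono_set (Ioo_subset_Ioo hs₁.1.le le_rfl)
    rw [show Ioo s₁ T = Ioo (0 + s₁) (T - s₁ + s₁) by rw [zero_add, sub_add_cancel]] at h
    exact h.translate s₁
  exact not_memLqLp_pressureGradient hν hTs hmax' hLH' h1q hqtop hsq hS'

/-- **THE QUANTIFIED PRESSURE FACE, ASSEMBLED**: on every terminal window the normalised pressure is in no class
`L^s_tL^r_x` with `2/s + 3/r = 2`, `3/2 < r < ∞`, and the pressure gradient in no class `L^s_tL^q_x` with
`2/s + 3/q = 3`, `1 < q < ∞`. [cite: LemarieRieusset2016, §11.5 Prop. 11.7] -/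
theorem pressure_serrin_face {ν T : ℝ} (hν : 0 < ν)
    {u : ℝ → EuclideanSpace ℝ (Fin 3) → EuclideanSpace ℝ (Fin 3)} {p : ℝ → EuclideanSpace ℝ (Fin 3) → ℝ}
    (hmax : IsMaximalSmoothSolution ν 0 u p T) (hLH : IsLerayHopfOn T ν 0 (u 0) u) :
    (∀ (s r : ℝ≥0∞), 3 / 2 < r → r < ⊤ → 2 / s + 3 / r = 2 → ∀ t₀ ∈ Ico 0 T,
        ¬ MemLqLp s r (fun t x => normalisedPressure (u t) x) (Ioo t₀ T)) ∧
      ∀ (s q : ℝ≥0∞), 1 < q → q < ⊤ → 2 / s + 3 / q = 3 → ∀ t₀ ∈ Ico 0 T,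
        ¬ MemLqLp s q (fun t x => gradient (p t) x) (Ioo t₀ T) :=
  ⟨fun _ _ hr hrtop hsr _ ht₀ => not_memLqLp_normalisedPressure_window hν hmax hLH hr hrtop hsr ht₀,
    fun _ _ h1q hqtop hsq _ ht₀ => not_memLqLp_pressureGradient_window hν hmax hLH h1q hqtop hsq ht₀⟩

end Summit.NavierStokesRegularity.FluidComputer.PressureSerrinFace

end
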